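import Literature.NumberTheory.LFunctions.ExplicitFormulaPsi
import Literature.NumberTheory.LFunctions.ExplicitFormulaPsiContour
import Literature.NumberTheory.LFunctions.PerronFormulaPsi
import HarnessLib

/-!
# The truncated explicit formula for `ψ` (Montgomery–Vaughan Thm. 12.5): proof

Topic: `Literature/NumberTheory/LFunctions`. THEOREMS (everything proved). DISCHARGE of the named
fact `Literature.NumberTheory.LFunctions.truncatedExplicitFormula_psi` (`ExplicitFormulaPsi.lean`),
Montgomery–Vaughan, *Multiplicative Number Theory I*, Thm. 12.5: for `c > 1` there is `C` with

  **`|ψ₀(x) − (x − ∑_{|γ| ≤ T} x^ρ/ρ − log 2π − ½ log(1 − 1/x²))| ≤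
    C ((log x) min(1, x/(T⟨x⟩)) + (x/T) log²(xT))`**   (`x ≥ c`, `T ≥ 2`),

`Literature.NumberTheory.LFunctions.truncatedExplicitFormula_psi_holds`. The proof is MV's
(pp. 400–401), assembled from

* Perron's formula with remainder for `ψ₀` at `σ₀ = b = 1 + 1/log x`
  (`Literature.NumberTheory.LFunctions.PerronPsi.perron_chebyshevPsi₀`, `PerronFormulaPsi.lean`,
  MV Thm. 5.2/Cor. 5.3): `ψ₀(x) = (1/2πi)∫_{b−iT₁}^{b+iT₁} (−ζ'/ζ)(s) x^s ds/s + R₁`;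
* a good height `T₁ ∈ [T, T+1]` at distance `η ≫ 1/log T` from every ordinate `±γ`
  (`exists_goodHeight_all`, from the tree's `ZetaLogDerivRH.exists_goodHeight`, MV Lemma 12.2);
* the residue theorem on `[−2K−1/2, b] × [−T₁, T₁]` with `K → ∞`
  (`Literature.NumberTheory.LFunctions.ExplicitPsi.rightEdge_identity`, `ExplicitFormulaPsiContour.lean`):
  `(1/2πi)∫_{b−iT₁}^{b+iT₁} = x − ∑_{|γ| ≤ T₁} m(ρ)x^ρ/ρ − log 2π − ½ log(1−x⁻²) + (horizontal
  integrals)/(2π)`;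
* the horizontal integrals `∫_{−∞}^{b} (−ζ'/ζ)(σ ± iT₁) x^{σ±iT₁}/(σ±iT₁) dσ ≪_c (x/T) log² T`
  (`horizontal_integral_bound`): `|ζ'/ζ(σ ± iT₁)| ≪ log² T` on `[−1/2, 3/2]` (MV Lemma 12.2, the
  tree's `PsiOneExplicit.exists_norm_logDeriv_riemannZeta_horizontal_le`), `≪ 1` on `σ ≥ 3/2`,
  and `≤ C + 5|σ| + 2 log T` on `σ ≤ −1/2` (`norm_logDeriv_riemannZeta_le_of_re_le_neg_half`, a
  crude form of MV Lemma 12.4 from the tree's `norm_logDeriv_riemannZeta_le_of_re_le`), against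
  `∫_{−∞}^{b} x^σ dσ = e x/log x`;
* the passage from `T₁` back to `T`: the zeros with `T < |γ| ≤ T₁` number `≪ log T` (MV Thm. 10.13,
  the tree's `exists_sum_zetaZeroWindow_le` with the reflection `ρ ↦ 1 − ρ̄` for `β < 1/4`,
  `sum_order_sdiff_le`) and each contributes `|x^ρ/ρ| ≤ x/T` (`norm_zeroSum_sub_le`).

All constants are explicit but not optimised; the dependence on `c` enters through `1/log c`.

## References

* H. L. Montgomery, R. C. Vaughan, *Multiplicative Number Theory I. Classical Theory*, CUP 2007,
  §12.1, Lemmas 12.1, 12.2, 12.4, Thm. 12.5; Thm. 10.13. [MontgomeryVaughan2007]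
-/

noncomputable section

open Complex Filter Set MeasureTheory Topology intervalIntegral
open scoped Real Interval ComplexConjugate

namespace Literature.NumberTheory.LFunctions

namespace ExplicitPsi

open PsiOneExplicit

/-! ### `ζ'/ζ` on the far-left horizontal lines (Montgomery–Vaughan Lemma 12.4, crude form) -/

/-- **`ζ'/ζ` far left, uniformly in `σ`**: for `σ ≤ −1/2` and `|t| ≥ 2`,
`‖ζ'/ζ(σ + it)‖ ≤ C_r + 17 + 5(−σ) + 2 log|t|` (`C_r` the constant of
`ZetaZeroSum.exists_norm_logDeriv_riemannXi_le_of_re_ge`; the tree's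
`norm_logDeriv_riemannZeta_le_of_re_le` with `K = ⌈−σ⌉`). This crude form of MV Lemma 12.4
(`≪ log(|s|+1)`) suffices against the weight `x^σ`. [cite: MontgomeryVaughan2007, Lemma 12.4] -/
theorem norm_logDeriv_riemannZeta_le_of_re_le_neg_half {Cr : ℝ}
    (hCr : ∀ s : ℂ, 3 / 2 ≤ s.re →
      ‖logDeriv riemannXi s‖ ≤ Cr + ‖s‖ ∧
        (1 ≤ |s.im| → ‖logDeriv riemannXi s‖ ≤ Cr + Real.log (1 + ‖s‖)))
    {σ t : ℝ} (hσ : σ ≤ -(1 / 2)) (ht : 2 ≤ |t|) :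
    ‖deriv riemannZeta (σ + t * I) / riemannZeta (σ + t * I)‖ ≤
      Cr + 17 + 5 * (-σ) + 2 * Real.log |t| := by
  set K : ℕ := ⌈-σ⌉₊ with hK
  have hK1 : -σ ≤ K := Nat.le_ceil _
  have hK2 : (K : ℝ) < -σ + 1 := Nat.ceil_lt_add_one (by linarith)
  have h := norm_logDeriv_riemannZeta_le_of_re_le hCr (K := K) (σ := σ) (t := t) (by linarith) hσ ht
  have hlog : Real.log (2 * K + 3 + |t|) ≤ (4 - 2 * σ) + Real.log |t| := by
    have h0 : (0 : ℝ) ≤ (4 - 2 * σ) * (|t| - 2) := mul_nonneg (by linarith) (by linarith)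
    have h1 : 2 * (K : ℝ) + 3 + |t| ≤ (5 - 2 * σ) * |t| := by nlinarith
    have h2 : Real.log (2 * K + 3 + |t|) ≤ Real.log ((5 - 2 * σ) * |t|) :=
      Real.log_le_log (by positivity) h1
    rw [Real.log_mul (by linarith) (by linarith)] at h2
    have h3 : Real.log (5 - 2 * σ) ≤ (5 - 2 * σ) - 1 := Real.log_le_sub_one_of_pos (by linarith)
    linarith
  linarith

/-! ### The integrand on the horizontal half-lines `(−∞, b] ± iT` -/

/-- The weight against `x^σ`: `5 max(−σ, 0) e^{Lσ} ≤ (10/(eL)) e^{Lσ/2}` (`L > 0`). [folklore] -/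
theorem max_neg_mul_exp_le {L σ : ℝ} (hL : 0 < L) :
    5 * max (-σ) 0 * Real.exp (L * σ) ≤ 10 / (Real.exp 1 * L) * Real.exp (L / 2 * σ) := by
  rcases le_or_gt 0 σ with hσ | hσ
  · rw [max_eq_right (by linarith)]
    simp only [mul_zero, zero_mul]
    positivity
  · rw [max_eq_left (by linarith)]
    -- `y e^{-y} ≤ 1/e` with `y = L(−σ)/2` (Mathlib's `Real.mul_exp_neg_le_exp_neg_one`)
    have h := Real.mul_exp_neg_le_exp_neg_one (L * (-σ) / 2)
    have hpos : 0 < Real.exp (L / 2 * σ) := Real.exp_pos _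
    have e1 : Real.exp (L * σ) = Real.exp (-(L * (-σ) / 2)) * Real.exp (L / 2 * σ) := by
      rw [← Real.exp_add]; ring_nf
    have he : Real.exp (-1) * Real.exp 1 = 1 := by rw [← Real.exp_add]; simp
    have key : 5 * -σ * Real.exp (-(L * (-σ) / 2)) ≤ 10 / (Real.exp 1 * L) := by
      rw [le_div_iff₀ (by positivity)]
      calc 5 * -σ * Real.exp (-(L * (-σ) / 2)) * (Real.exp 1 * L)
          = 10 * Real.exp 1 * (L * (-σ) / 2 * Real.exp (-(L * (-σ) / 2))) := by ring
        _ ≤ 10 * Real.exp 1 * Real.exp (-1) := mul_le_mul_of_nonneg_left h (by positivity)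
        _ = 10 := by rw [mul_assoc, mul_comm (Real.exp 1), he, mul_one]
    rw [e1]
    calc 5 * -σ * (Real.exp (-(L * (-σ) / 2)) * Real.exp (L / 2 * σ))
        = (5 * -σ * Real.exp (-(L * (-σ) / 2))) * Real.exp (L / 2 * σ) := by ring
      _ ≤ 10 / (Real.exp 1 * L) * Real.exp (L / 2 * σ) := mul_le_mul_of_nonneg_right key hpos.le

/-- **Pointwise bound on the half-lines.** Let `x > 1`, `|t| ≥ 2`, `0 < η ≤ 1` with all non-trivial
zeros `η`-away from the ordinate `t`, and
`Λ₀ ≥ C_r + 17 + 2 log|t| + C_h log(|t|+4)/η + M₀` (`M₀ = ∑ Λ(n) n^{−3/2}`). Then for every `σ`,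
`‖(−ζ'/ζ)(σ+it) x^{σ+it}/(σ+it)‖ ≤ (Λ₀ + 5 max(−σ,0)) x^σ/|t|`: on `σ ≤ −1/2` by the far-left
bound (MV Lemma 12.4), on `[−1/2, 3/2]` by the good-height bound (MV Lemma 12.2), on `σ ≥ 3/2` by
the Dirichlet series. [cite: MontgomeryVaughan2007, Thm. 12.5 (proof)] -/
theorem norm_integrand_horizontal_le {Cr Ch : ℝ}
    (hCr : ∀ s : ℂ, 3 / 2 ≤ s.re →
      ‖logDeriv riemannXi s‖ ≤ Cr + ‖s‖ ∧
        (1 ≤ |s.im| → ‖logDeriv riemannXi s‖ ≤ Cr + Real.log (1 + ‖s‖)))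
    (hCh : ∀ (t η : ℝ), 2 ≤ |t| → 0 < η → η ≤ 1 →
      (∀ ρ ∈ RHWave0.riemannZetaNontrivialZeros, η ≤ |ρ.im - t|) →
      ∀ σ : ℝ, σ ∈ Icc (-(1 / 2) : ℝ) (3 / 2) →
        ‖deriv riemannZeta (σ + t * I) / riemannZeta (σ + t * I)‖ ≤ Ch * Real.log (|t| + 4) / η)
    {x t η Λ₀ : ℝ} (hx : 0 < x) (ht : 2 ≤ |t|) (hη : 0 < η) (hη1 : η ≤ 1)
    (hZ : ∀ ρ ∈ RHWave0.riemannZetaNontrivialZeros, η ≤ |ρ.im - t|)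
    (hΛ₀ : Cr + 17 + 2 * Real.log |t| + Ch * Real.log (|t| + 4) / η +
      ∑' n : ℕ, ‖LSeries.term (fun n ↦ (ArithmeticFunction.vonMangoldt n : ℂ)) (3 / 2 : ℂ) n‖ ≤ Λ₀)
    (hCh0 : 0 ≤ Ch) (hCr0 : 0 ≤ Cr) (σ : ℝ) :
    ‖(fun s : ℂ ↦ (-deriv riemannZeta s / riemannZeta s) * ((x : ℂ) ^ s / s)) ((σ : ℂ) + t * I)‖ ≤
      (Λ₀ + 5 * max (-σ) 0) * (x ^ σ / |t|) := by
  have ht0 : t ≠ 0 := fun h ↦ by rw [h, abs_zero] at ht; linarith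
  have hM₀0 : 0 ≤ ∑' n : ℕ, ‖LSeries.term (fun n ↦ (ArithmeticFunction.vonMangoldt n : ℂ)) (3 / 2 : ℂ) n‖ :=
    tsum_nonneg fun _ ↦ norm_nonneg _
  have hlogt : 0 ≤ Real.log |t| := Real.log_nonneg (by linarith)
  have hlog4 : 0 ≤ Real.log (|t| + 4) := Real.log_nonneg (by linarith)
  have hmax : 0 ≤ max (-σ) 0 := le_max_right _ _
  have hCη : 0 ≤ Ch * Real.log (|t| + 4) / η := by positivity
  have hΛ₀0 : 0 ≤ Λ₀ := le_trans (by positivity) hΛ₀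
  have hk := norm_cpow_div_le_horizontal hx σ ht0
  show ‖(-deriv riemannZeta ((σ : ℂ) + t * I) / riemannZeta ((σ : ℂ) + t * I)) *
      ((x : ℂ) ^ ((σ : ℂ) + t * I) / ((σ : ℂ) + t * I))‖ ≤ _
  rw [norm_mul, neg_div, norm_neg]
  refine mul_le_mul ?_ hk (norm_nonneg _) (by positivity)
  rcases le_or_gt σ (-(1 / 2)) with h1 | h1
  · have h := norm_logDeriv_riemannZeta_le_of_re_le_neg_half hCr h1 ht
    have : 5 * (-σ) ≤ 5 * max (-σ) 0 := by linarith [le_max_left (-σ) 0]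
    linarith
  rcases le_or_gt σ (3 / 2) with h2 | h2
  · have h := hCh t η ht hη hη1 hZ σ ⟨h1.le, h2⟩
    linarith
  · have hs : 3 / 2 ≤ ((σ : ℂ) + t * I).re := by simp; linarith
    have hs1 : 1 < ((σ : ℂ) + t * I).re := by simp; linarith
    have h := ZetaZeroSum.norm_LSeries_vonMangoldt_le_of_re_ge hs
    rw [ArithmeticFunction.LSeries_vonMangoldt_eq_deriv_riemannZeta_div hs1, neg_div, norm_neg] at h
    linarith

/-- `ζ(σ + it) ≠ 0` for all `σ` when `t ≠ 0` is at positive distance from every ordinate. [folklore] -/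
theorem riemannZeta_ne_zero_of_goodHeight {t η : ℝ} (ht : t ≠ 0) (hη : 0 < η)
    (hZ : ∀ ρ ∈ RHWave0.riemannZetaNontrivialZeros, η ≤ |ρ.im - t|) (σ : ℝ) :
    riemannZeta ((σ : ℂ) + t * I) ≠ 0 := by
  intro h0
  have hmem := ZetaZeros.riemannZetaNontrivialZeros.mem_of_im_ne_zero h0 (by simpa using ht)
  have := hZ _ hmem
  simp at this
  linarith

/-- Continuity of `σ ↦ (−ζ'/ζ)(σ+it) x^{σ+it}/(σ+it)` at a good height `t`. [folklore] -/
theorem continuous_integrand_horizontal {x t η : ℝ} (hx : 0 < x) (ht : t ≠ 0) (hη : 0 < η)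
    (hZ : ∀ ρ ∈ RHWave0.riemannZetaNontrivialZeros, η ≤ |ρ.im - t|) :
    Continuous fun σ : ℝ ↦
      (fun s : ℂ ↦ (-deriv riemannZeta s / riemannZeta s) * ((x : ℂ) ^ s / s)) ((σ : ℂ) + t * I) := by
  refine continuous_iff_continuousAt.2 fun σ ↦ ?_
  have h := continuousAt_integrand hx (riemannZeta_ne_zero_of_goodHeight ht hη hZ σ)
    (fun h ↦ ht (by simpa using congrArg Complex.im h)) (fun h ↦ ht (by simpa using congrArg Complex.im h))
  exact h.comp (f := fun σ : ℝ ↦ (σ : ℂ) + t * I) (Continuous.continuousAt (by fun_prop))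

/-- **The horizontal half-lines.** Under the hypotheses of `norm_integrand_horizontal_le`, for
`x > 1` and `b = 1 + 1/log x`, the integrand is integrable on `(−∞, b] + it` and
`‖∫_{−∞}^{b} (−ζ'/ζ)(σ+it) x^{σ+it}/(σ+it) dσ‖ ≤ e·x·(Λ₀/log x + 20/(e log² x))/|t|`
(majorant `(Λ₀ x^σ + (10/(e log x)) x^{σ/2})/|t|`, `∫_{−∞}^{b} x^σ dσ = x^b/log x = e x/log x`;
MV p. 401: "`∫_{−1}^{σ₀} … ≪ (log T)²/T ∫ x^σ dσ ≪ x (log T)²/(T log x)`",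
"`∫_{−K}^{−1} … ≪ (log T)/T ∫_{−∞}^{−1} x^σ dσ`"). [cite: MontgomeryVaughan2007, Thm. 12.5 (proof)] -/
theorem horizontal_integral_bound {Cr Ch : ℝ}
    (hCr : ∀ s : ℂ, 3 / 2 ≤ s.re →
      ‖logDeriv riemannXi s‖ ≤ Cr + ‖s‖ ∧
        (1 ≤ |s.im| → ‖logDeriv riemannXi s‖ ≤ Cr + Real.log (1 + ‖s‖)))
    (hCh : ∀ (t η : ℝ), 2 ≤ |t| → 0 < η → η ≤ 1 →
      (∀ ρ ∈ RHWave0.riemannZetaNontrivialZeros, η ≤ |ρ.im - t|) →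
      ∀ σ : ℝ, σ ∈ Icc (-(1 / 2) : ℝ) (3 / 2) →
        ‖deriv riemannZeta (σ + t * I) / riemannZeta (σ + t * I)‖ ≤ Ch * Real.log (|t| + 4) / η)
    {x t η Λ₀ b : ℝ} (hx : 1 < x) (hb : b = 1 + 1 / Real.log x) (ht : 2 ≤ |t|) (hη : 0 < η)
    (hη1 : η ≤ 1) (hZ : ∀ ρ ∈ RHWave0.riemannZetaNontrivialZeros, η ≤ |ρ.im - t|)
    (hΛ₀ : Cr + 17 + 2 * Real.log |t| + Ch * Real.log (|t| + 4) / η +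
      ∑' n : ℕ, ‖LSeries.term (fun n ↦ (ArithmeticFunction.vonMangoldt n : ℂ)) (3 / 2 : ℂ) n‖ ≤ Λ₀)
    (hCh0 : 0 ≤ Ch) (hCr0 : 0 ≤ Cr) :
    IntegrableOn (fun σ : ℝ ↦
      (fun s : ℂ ↦ (-deriv riemannZeta s / riemannZeta s) * ((x : ℂ) ^ s / s)) ((σ : ℂ) + t * I))
      (Iic b) ∧
    ‖∫ σ in Iic b,
        (fun s : ℂ ↦ (-deriv riemannZeta s / riemannZeta s) * ((x : ℂ) ^ s / s)) ((σ : ℂ) + t * I)‖ ≤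
      Real.exp 1 * x * (Λ₀ / Real.log x + 20 / (Real.exp 1 * Real.log x ^ 2)) / |t| := by
  have hx0 : 0 < x := by linarith
  have ht0 : t ≠ 0 := fun h ↦ by rw [h, abs_zero] at ht; linarith
  have htpos : 0 < |t| := by linarith
  have hL0 : 0 < Real.log x := Real.log_pos hx
  have hM₀0 : 0 ≤ ∑' n : ℕ, ‖LSeries.term (fun n ↦ (ArithmeticFunction.vonMangoldt n : ℂ)) (3 / 2 : ℂ) n‖ :=
    tsum_nonneg fun _ ↦ norm_nonneg _
  have hlogt : 0 ≤ Real.log |t| := Real.log_nonneg (by linarith)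
  have hlog4 : 0 ≤ Real.log (|t| + 4) := Real.log_nonneg (by linarith)
  have hCη : 0 ≤ Ch * Real.log (|t| + 4) / η := by positivity
  have hΛ₀0 : 0 ≤ Λ₀ := le_trans (by positivity) hΛ₀
  set G : ℝ → ℂ := fun σ ↦
    (fun s : ℂ ↦ (-deriv riemannZeta s / riemannZeta s) * ((x : ℂ) ^ s / s)) ((σ : ℂ) + t * I) with hG
  -- the majorant
  set m : ℝ → ℝ := fun σ ↦ (Λ₀ * Real.exp (Real.log x * σ) +
    10 / (Real.exp 1 * Real.log x) * Real.exp (Real.log x / 2 * σ)) / |t| with hm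
  have hGm : ∀ σ : ℝ, ‖G σ‖ ≤ m σ := by
    intro σ
    have h := norm_integrand_horizontal_le hCr hCh hx0 ht hη hη1 hZ hΛ₀ hCh0 hCr0 σ
    refine h.trans ?_
    have hw := max_neg_mul_exp_le (σ := σ) hL0
    rw [hm]
    simp only
    rw [Real.rpow_def_of_pos hx0, mul_div_assoc']
    refine div_le_div_of_nonneg_right ?_ htpos.le
    nlinarith [Real.exp_pos (Real.log x * σ)]
  have hGcont : Continuous G := continuous_integrand_horizontal hx0 ht0 hη hZ
  have hm_int : Integrable m (volume.restrict (Iic b)) := by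
    have h1 : IntegrableOn (fun σ : ℝ ↦ Real.exp (Real.log x * σ)) (Iic b) :=
      integrableOn_exp_mul_Iic hL0 b
    have h2 : IntegrableOn (fun σ : ℝ ↦ Real.exp (Real.log x / 2 * σ)) (Iic b) :=
      integrableOn_exp_mul_Iic (half_pos hL0) b
    exact ((h1.const_mul Λ₀).add (h2.const_mul _)).div_const |t|
  have hG_int : IntegrableOn G (Iic b) :=
    Integrable.mono' hm_int hGcont.aestronglyMeasurable (ae_of_all _ hGm)
  refine ⟨hG_int, ?_⟩
  -- the integral of the majorant
  have hint_m : ∫ σ in Iic b, m σ = (Λ₀ * (Real.exp (Real.log x * b) / Real.log x) +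
      10 / (Real.exp 1 * Real.log x) * (Real.exp (Real.log x / 2 * b) / (Real.log x / 2))) / |t| := by
    have h1 : IntegrableOn (fun σ : ℝ ↦ Real.exp (Real.log x * σ)) (Iic b) :=
      integrableOn_exp_mul_Iic hL0 b
    have h2 : IntegrableOn (fun σ : ℝ ↦ Real.exp (Real.log x / 2 * σ)) (Iic b) :=
      integrableOn_exp_mul_Iic (half_pos hL0) b
    rw [hm]
    simp only
    rw [MeasureTheory.integral_div, MeasureTheory.integral_add (h1.const_mul Λ₀) (h2.const_mul _),
      MeasureTheory.integral_const_mul, MeasureTheory.integral_const_mul,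
      integral_exp_mul_Iic hL0, integral_exp_mul_Iic (half_pos hL0)]
  have hexb : Real.exp (Real.log x * b) = Real.exp 1 * x := by
    rw [hb, mul_add, mul_one, mul_one_div_cancel hL0.ne', Real.exp_add, Real.exp_log hx0, mul_comm]
  have hexb2 : Real.exp (Real.log x / 2 * b) ≤ Real.exp 1 * x := by
    rw [← hexb]
    refine Real.exp_le_exp.2 ?_
    have hb0 : 0 < b := by rw [hb]; positivity
    nlinarith
  calc ‖∫ σ in Iic b, G σ‖ ≤ ∫ σ in Iic b, m σ :=
        norm_integral_le_of_norm_le hm_int (ae_of_all _ hGm)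
    _ = (Λ₀ * (Real.exp (Real.log x * b) / Real.log x) +
          10 / (Real.exp 1 * Real.log x) * (Real.exp (Real.log x / 2 * b) / (Real.log x / 2))) / |t| :=
        hint_m
    _ ≤ (Λ₀ * (Real.exp 1 * x / Real.log x) +
          10 / (Real.exp 1 * Real.log x) * (Real.exp 1 * x / (Real.log x / 2))) / |t| := by
        rw [hexb]
        gcongr
    _ = Real.exp 1 * x * (Λ₀ / Real.log x + 20 / (Real.exp 1 * Real.log x ^ 2)) / |t| := by
        field_simp
        ring

/-! ### Good heights for all the non-trivial zeros (Montgomery–Vaughan Lemma 12.2) -/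

/-- **Good heights.** There is `c₀ > 0` such that every interval `[T, T + 1]` (`T ≥ 0`) contains a
height `T₁` and an `η ∈ (0, 1]` with `1/η ≤ 2 + log(T₁+2)/c₀` such that every non-trivial zero
`ρ` has `|Im ρ − T₁| ≥ η` and `|Im ρ + T₁| ≥ η` (the tree's `ZetaLogDerivRH.exists_goodHeight`
covers the zeros with `Re ρ ≥ 1/4`; the others are reflected by `ρ ↦ 1 − ρ̄`, and `−T₁` is handled
by conjugation). [cite: MontgomeryVaughan2007, Lemma 12.2 (proof)] -/
theorem exists_goodHeight_all :
    ∃ c₀ : ℝ, 0 < c₀ ∧ ∀ T : ℝ, 0 ≤ T → ∃ T₁ : ℝ, T ≤ T₁ ∧ T₁ ≤ T + 1 ∧ ∃ η : ℝ, 0 < η ∧ η ≤ 1 ∧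
      1 / η ≤ 2 + Real.log (T₁ + 2) / c₀ ∧
      ∀ ρ ∈ RHWave0.riemannZetaNontrivialZeros, η ≤ |ρ.im - T₁| ∧ η ≤ |ρ.im + T₁| := by
  obtain ⟨c₀, hc₀, hgood⟩ := ZetaLogDerivRH.exists_goodHeight
  refine ⟨c₀, hc₀, fun T hT ↦ ?_⟩
  obtain ⟨T₁, ⟨h1, h2⟩, hsep⟩ := hgood T
  have hT₁0 : 0 ≤ T₁ := hT.trans h1
  rw [abs_of_nonneg hT₁0] at hsep
  have hlog : 0 < Real.log (T₁ + 2) := Real.log_pos (by linarith)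
  set η : ℝ := min (1 / 2) (c₀ / Real.log (T₁ + 2)) with hη
  have hη0 : 0 < η := lt_min (by norm_num) (div_pos hc₀ hlog)
  have hη1 : η ≤ 1 := (min_le_left _ _).trans (by norm_num)
  have H : ∀ ρ ∈ RHWave0.riemannZetaNontrivialZeros, η ≤ |ρ.im - T₁| := by
    intro ρ hρ
    rcases le_or_gt (1 / 4 : ℝ) ρ.re with h | h
    · exact (min_le_right _ _).trans (hsep ρ ⟨ZetaZeros.riemannZetaNontrivialZeros.zeta_eq_zero hρ, h⟩)
    · have h' := ZetaZeros.riemannZetaNontrivialZeros.one_sub_conj_mem hρ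
      have h1 := hsep _ ⟨ZetaZeros.riemannZetaNontrivialZeros.zeta_eq_zero h', by simp; linarith⟩
      simp only [sub_im, one_im, conj_im, zero_sub, neg_neg] at h1
      exact (min_le_right _ _).trans h1
  refine ⟨T₁, h1, h2, η, hη0, hη1, ?_, fun ρ hρ ↦ ⟨H ρ hρ, ?_⟩⟩
  · rw [hη]
    rcases min_cases (1 / 2 : ℝ) (c₀ / Real.log (T₁ + 2)) with ⟨h, -⟩ | ⟨h, -⟩
    · rw [h, show (1 : ℝ) / (1 / 2) = 2 by norm_num]
      have : 0 ≤ Real.log (T₁ + 2) / c₀ := by positivity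
      linarith
    · rw [h, one_div_div]
      linarith
  · have h := H _ (ZetaZeros.riemannZetaNontrivialZeros.conj_mem hρ)
    rw [conj_im] at h
    rwa [show -ρ.im - T₁ = -(ρ.im + T₁) by ring, abs_neg] at h

/-! ### From `T₁` back to `T`: zeros in a unit window (Montgomery–Vaughan Thm. 10.13) -/

/-- A finite set of non-trivial zeros in the horizontal strip `|Im ρ − τ| ≤ 1/2` has total
multiplicity at most twice that of the window `zetaZeroWindow τ` (the zeros with `Re ρ < 1/4` are
reflected into it by `ρ ↦ 1 − ρ̄`, which preserves ordinates and multiplicities). [folklore] -/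
theorem sum_order_le_two_mul_window (P : Finset ℂ) (τ : ℝ)
    (hP : ∀ ρ ∈ P, riemannZeta ρ = 0 ∧ 0 < ρ.re ∧ ρ.re < 1 ∧ |ρ.im - τ| ≤ 1 / 2) :
    ∑ ρ ∈ P, (riemannZetaZeroOrder ρ : ℝ) ≤
      2 * ∑ ρ ∈ (zetaZeroWindow_finite τ).toFinset, (riemannZetaZeroOrder ρ : ℝ) := by
  classical
  set W := (zetaZeroWindow_finite τ).toFinset with hW
  have hWnn : ∀ ρ ∈ W, (0 : ℝ) ≤ riemannZetaZeroOrder ρ := by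
    intro ρ hρ
    rw [hW, Set.Finite.mem_toFinset] at hρ
    exact_mod_cast riemannZetaZeroOrder_nonneg (ne_one_of_riemannZeta_eq_zero hρ.1)
  rw [← Finset.sum_filter_add_sum_filter_not P (fun ρ : ℂ ↦ (1 / 4 : ℝ) ≤ ρ.re), two_mul]
  refine add_le_add ?_ ?_
  · refine Finset.sum_le_sum_of_subset_of_nonneg (fun ρ hρ ↦ ?_) (fun ρ hρ _ ↦ hWnn ρ hρ)
    rw [Finset.mem_filter] at hρ
    obtain ⟨h0, -, -, h3⟩ := hP ρ hρ.1
    rw [hW, Set.Finite.mem_toFinset]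
    exact ⟨h0, hρ.2, h3⟩
  · set r : ℂ → ℂ := fun ρ ↦ 1 - conj ρ with hr
    have hinj : Set.InjOn r ↑(P.filter (fun ρ : ℂ ↦ ¬ (1 / 4 : ℝ) ≤ ρ.re)) := by
      intro a _ b _ h
      simp only [hr] at h
      have h' : conj a = conj b := sub_right_injective h
      simpa using congrArg conj h'
    have heq : ∑ ρ ∈ P.filter (fun ρ : ℂ ↦ ¬ (1 / 4 : ℝ) ≤ ρ.re), (riemannZetaZeroOrder ρ : ℝ) =
        ∑ u ∈ (P.filter (fun ρ : ℂ ↦ ¬ (1 / 4 : ℝ) ≤ ρ.re)).image r, (riemannZetaZeroOrder u : ℝ) := by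
      rw [Finset.sum_image hinj]
      refine Finset.sum_congr rfl fun ρ hρ ↦ ?_
      rw [Finset.mem_filter] at hρ
      obtain ⟨-, h1, h2, -⟩ := hP ρ hρ.1
      simp only [hr]
      rw [riemannZetaZeroOrder_one_sub_conj h1 h2]
    rw [heq]
    refine Finset.sum_le_sum_of_subset_of_nonneg (fun u hu ↦ ?_) (fun ρ hρ _ ↦ hWnn ρ hρ)
    rw [Finset.mem_image] at hu
    obtain ⟨ρ, hρ, rfl⟩ := hu
    rw [Finset.mem_filter, not_le] at hρ
    obtain ⟨h0, h1, h2, h3⟩ := hP ρ hρ.1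
    have hmem : ρ ∈ RHWave0.riemannZetaNontrivialZeros :=
      ZetaZeros.riemannZetaNontrivialZeros.mem_iff'.2 ⟨h0, h1, h2⟩
    have h' := ZetaZeros.riemannZetaNontrivialZeros.one_sub_conj_mem hmem
    rw [hW, Set.Finite.mem_toFinset]
    refine ⟨ZetaZeros.riemannZetaNontrivialZeros.zeta_eq_zero h', ?_, ?_⟩
    · simp [hr]; linarith
    · simpa [hr] using h3

/-- **Zeros between `T` and `T₁ ≤ T + 1`** (MV Thm. 10.13 in the form `N(T+1) − N(T) ≪ log T`): with
`C_w` the window constant of `exists_sum_zetaZeroWindow_le`, the non-trivial zeros with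
`T < |Im ρ| ≤ T₁` have total multiplicity `≤ 4 C_w log(T + 5/2)`. [cite: MontgomeryVaughan2007, Thm. 10.13] -/
theorem sum_order_sdiff_le {Cw : ℝ}
    (hCw : ∀ τ : ℝ, ∑ ρ ∈ (zetaZeroWindow_finite τ).toFinset, (riemannZetaZeroOrder ρ : ℝ) ≤
      Cw * Real.log (|τ| + 2))
    {T T₁ : ℝ} (hT : 0 ≤ T) (h2 : T₁ ≤ T + 1) :
    ∑ ρ ∈ (weilZeroIndex_finite T₁).toFinset \ (weilZeroIndex_finite T).toFinset,
        (riemannZetaZeroOrder ρ : ℝ) ≤ 4 * Cw * Real.log (T + 5 / 2) := by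
  classical
  set D := (weilZeroIndex_finite T₁).toFinset \ (weilZeroIndex_finite T).toFinset with hD
  have hmemD : ∀ ρ ∈ D, riemannZeta ρ = 0 ∧ 0 < ρ.re ∧ ρ.re < 1 ∧ T < |ρ.im| ∧ |ρ.im| ≤ T₁ := by
    intro ρ hρ
    rw [hD, Finset.mem_sdiff, Set.Finite.mem_toFinset, Set.Finite.mem_toFinset] at hρ
    obtain ⟨⟨h0, hr0, hr1, him, hle⟩, hnot⟩ := hρ
    have hmem := ZetaZeros.riemannZetaNontrivialZeros.mem_of_im_ne_zero h0 him
    refine ⟨h0, ZetaZeros.riemannZetaNontrivialZeros.re_pos hmem, ZetaZeros.riemannZetaNontrivialZeros.re_lt_one hmem, ?_, hle⟩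
    by_contra hle'
    exact hnot ⟨h0, hr0, hr1, him, not_lt.1 hle'⟩
  rw [← Finset.sum_filter_add_sum_filter_not D (fun ρ : ℂ ↦ 0 < ρ.im)]
  have habs1 : |T + 1 / 2| + 2 = T + 5 / 2 := by rw [abs_of_nonneg (by linarith)]; ring
  have habs2 : |-(T + 1 / 2)| + 2 = T + 5 / 2 := by rw [abs_neg, abs_of_nonneg (by linarith)]; ring
  have hpos : ∑ ρ ∈ D.filter (fun ρ : ℂ ↦ 0 < ρ.im), (riemannZetaZeroOrder ρ : ℝ) ≤
      2 * (Cw * Real.log (T + 5 / 2)) := by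
    refine (sum_order_le_two_mul_window _ (T + 1 / 2) fun ρ hρ ↦ ?_).trans ?_
    · rw [Finset.mem_filter] at hρ
      obtain ⟨h0, hr0, hr1, hgt, hle⟩ := hmemD ρ hρ.1
      rw [abs_of_pos hρ.2] at hgt hle
      exact ⟨h0, hr0, hr1, abs_le.2 ⟨by linarith, by linarith⟩⟩
    · have h := hCw (T + 1 / 2)
      rw [habs1] at h
      linarith
  have hneg : ∑ ρ ∈ D.filter (fun ρ : ℂ ↦ ¬ 0 < ρ.im), (riemannZetaZeroOrder ρ : ℝ) ≤
      2 * (Cw * Real.log (T + 5 / 2)) := by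
    refine (sum_order_le_two_mul_window _ (-(T + 1 / 2)) fun ρ hρ ↦ ?_).trans ?_
    · rw [Finset.mem_filter, not_lt] at hρ
      obtain ⟨h0, hr0, hr1, hgt, hle⟩ := hmemD ρ hρ.1
      have him : ρ.im ≠ 0 := ZetaZeros.riemannZetaNontrivialZeros.im_ne_zero
        (ZetaZeros.riemannZetaNontrivialZeros.mem_iff'.2 ⟨h0, hr0, hr1⟩)
      have hneg' : ρ.im < 0 := lt_of_le_of_ne hρ.2 him
      rw [abs_of_neg hneg'] at hgt hle
      exact ⟨h0, hr0, hr1, abs_le.2 ⟨by linarith, by linarith⟩⟩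
    · have h := hCw (-(T + 1 / 2))
      rw [habs2] at h
      linarith
  linarith

/-- **The tail of the zero sum** (`x ≥ 1`, `0 < T ≤ T₁`):
`‖∑_{|Im ρ| ≤ T₁} m(ρ)x^ρ/ρ − ∑_{|Im ρ| ≤ T} m(ρ)x^ρ/ρ‖ ≤ (x/T) ∑_{T < |Im ρ| ≤ T₁} m(ρ)`
(`|x^ρ| = x^{Re ρ} ≤ x`, `|ρ| ≥ |Im ρ| > T`). [cite: MontgomeryVaughan2007, Thm. 12.5 (proof)] -/
theorem norm_zeroSum_sub_le {x T T₁ : ℝ} (hx : 1 ≤ x) (hT : 0 < T) (h1 : T ≤ T₁) :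
    ‖∑ ρ ∈ (weilZeroIndex_finite T₁).toFinset, (riemannZetaZeroOrder ρ : ℂ) * ((x : ℂ) ^ ρ / ρ) -
        ∑ ρ ∈ (weilZeroIndex_finite T).toFinset, (riemannZetaZeroOrder ρ : ℂ) * ((x : ℂ) ^ ρ / ρ)‖ ≤
      x / T * ∑ ρ ∈ (weilZeroIndex_finite T₁).toFinset \ (weilZeroIndex_finite T).toFinset,
        (riemannZetaZeroOrder ρ : ℝ) := by
  classical
  have hsub : (weilZeroIndex_finite T).toFinset ⊆ (weilZeroIndex_finite T₁).toFinset := by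
    intro ρ hρ
    rw [Set.Finite.mem_toFinset] at hρ ⊢
    exact ⟨hρ.1, hρ.2.1, hρ.2.2.1, hρ.2.2.2.1, hρ.2.2.2.2.trans h1⟩
  rw [← Finset.sum_sdiff hsub, add_sub_cancel_right, Finset.mul_sum]
  refine (norm_sum_le _ _).trans (Finset.sum_le_sum fun ρ hρ ↦ ?_)
  rw [Finset.mem_sdiff, Set.Finite.mem_toFinset, Set.Finite.mem_toFinset] at hρ
  obtain ⟨⟨h0, hr0, hr1, him, hle⟩, hnot⟩ := hρ
  have hgt : T < |ρ.im| := by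
    by_contra h
    exact hnot ⟨h0, hr0, hr1, him, not_lt.1 h⟩
  have hρ1 : ρ ≠ 1 := ne_one_of_riemannZeta_eq_zero h0
  have hm0 : (0 : ℝ) ≤ riemannZetaZeroOrder ρ := by exact_mod_cast riemannZetaZeroOrder_nonneg hρ1
  have hnorm : T ≤ ‖ρ‖ := hgt.le.trans (Complex.abs_im_le_norm ρ)
  rw [norm_mul, Complex.norm_intCast, norm_div, Complex.norm_cpow_eq_rpow_re_of_pos (by linarith),
    abs_of_nonneg hm0]
  have hxre : x ^ ρ.re ≤ x := by
    calc x ^ ρ.re ≤ x ^ (1 : ℝ) := Real.rpow_le_rpow_of_exponent_le hx hr1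
      _ = x := Real.rpow_one x
  calc (riemannZetaZeroOrder ρ : ℝ) * (x ^ ρ.re / ‖ρ‖) ≤ (riemannZetaZeroOrder ρ : ℝ) * (x / T) := by
        refine mul_le_mul_of_nonneg_left ?_ hm0
        exact div_le_div₀ (by linarith) hxre hT hnorm
    _ = x / T * (riemannZetaZeroOrder ρ : ℝ) := by ring

end ExplicitPsi

/-! ### Assembly: Montgomery–Vaughan Thm. 12.5 -/

set_option maxHeartbeats 1600000 in
open ExplicitPsi PsiOneExplicit in
/-- **MV Thm. 12.5, PROVED** (the truncated explicit formula for `ψ`, Montgomery–Vaughan,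
*Multiplicative Number Theory I*, Thm. 12.5, (12.3)–(12.4)): for every `c > 1` there is `C` with
`|ψ₀(x) − (x − ∑_{|γ| ≤ T} x^ρ/ρ − log 2π − ½ log(1 − 1/x²))| ≤
  C ((log x) min(1, x/(T⟨x⟩)) + (x/T) log²(xT))` for all `x ≥ c`, `T ≥ 2`.
Proof as in MV pp. 400–401: Perron's formula for `ψ₀` with its remainder
(`PerronPsi.perron_chebyshevPsi₀`), a good height `T₁ ∈ [T, T+1]` (`exists_goodHeight_all`), the
residue theorem on `[−2K−1/2, 1+1/log x] × [−T₁, T₁]` with `K → ∞`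
(`ExplicitPsi.rightEdge_identity`), the horizontal integrals being
`≪_c (x/T) log² T` (`horizontal_integral_bound`), and finally the zeros with `T < |γ| ≤ T₁`,
`≪ log T` in number, each contributing `≤ x/T` (`sum_order_sdiff_le`, `norm_zeroSum_sub_le`).
This discharges the named fact `truncatedExplicitFormula_psi`. [cite: MontgomeryVaughan2007, Thm. 12.5] -/
theorem truncatedExplicitFormula_psi_holds : truncatedExplicitFormula_psi := by
  intro c hc
  -- constants
  obtain ⟨C₁, hC₁0, hPerron⟩ := PerronPsi.perron_chebyshevPsi₀ hc
  obtain ⟨Cr, hCr0, hCr⟩ := ZetaZeroSum.exists_norm_logDeriv_riemannXi_le_of_re_ge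
  obtain ⟨Ch, hCh0, hCh⟩ := PsiOneExplicit.exists_norm_logDeriv_riemannZeta_horizontal_le
  obtain ⟨c₀, hc₀0, hgoodH⟩ := exists_goodHeight_all
  obtain ⟨Cw, hCw0, hCw⟩ := exists_sum_zetaZeroWindow_le
  obtain ⟨δ, hδ0, hδ2, hgap⟩ := ZetaZeroSum.exists_gap_im
  set M₀ : ℝ := ∑' n : ℕ, ‖LSeries.term (fun n ↦ (ArithmeticFunction.vonMangoldt n : ℂ)) (3 / 2 : ℂ) n‖
    with hM₀
  have hM₀0 : 0 ≤ M₀ := tsum_nonneg fun _ ↦ norm_nonneg _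
  set lam : ℝ := Real.log c with hlam
  have hlam0 : 0 < lam := Real.log_pos hc
  set A₀ : ℝ := Cr + 19 + M₀ + 2 * Ch + Ch / c₀ with hA₀
  have hA₀0 : 0 ≤ A₀ := by positivity
  set A₁ : ℝ := Real.exp 1 * (A₀ / lam + 20 / (Real.exp 1 * lam ^ 2)) with hA₁
  have hA₁0 : 0 ≤ A₁ := by positivity
  refine ⟨C₁ + 3 * A₁ + 24 * Cw, fun x hx T hT ↦ ?_⟩
  -- basics
  have hx1 : 1 < x := hc.trans_le hx
  have hx0 : 0 < x := by linarith
  have hL0 : 0 < Real.log x := Real.log_pos hx1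
  have hLlam : lam ≤ Real.log x := Real.log_le_log (by linarith) hx
  set b : ℝ := 1 + 1 / Real.log x with hb
  have hb1 : 1 < b := by rw [hb]; simp [hL0]
  have hT0 : 0 < T := by linarith
  -- a good height `T₁ ∈ [T, T+1]`
  obtain ⟨T₁, hT₁, hT₁', η, hη0, hη1, hηinv, hZ⟩ := hgoodH T (by linarith)
  have hT₁2 : 2 ≤ T₁ := hT.trans hT₁
  have hT₁0 : 0 < T₁ := by linarith
  have hgood : ∀ ρ ∈ RHWave0.riemannZetaNontrivialZeros, ρ.im ≠ T₁ ∧ ρ.im ≠ -T₁ := by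
    intro ρ hρ
    obtain ⟨h1, h2⟩ := hZ ρ hρ
    refine ⟨fun h ↦ ?_, fun h ↦ ?_⟩
    · rw [h, sub_self, abs_zero] at h1; linarith
    · rw [h, neg_add_cancel, abs_zero] at h2; linarith
  have hZtop : ∀ ρ ∈ RHWave0.riemannZetaNontrivialZeros, η ≤ |ρ.im - T₁| := fun ρ hρ ↦ (hZ ρ hρ).1
  have hZbot : ∀ ρ ∈ RHWave0.riemannZetaNontrivialZeros, η ≤ |ρ.im - (-T₁)| := fun ρ hρ ↦ by
    rw [sub_neg_eq_add]; exact (hZ ρ hρ).2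
  -- `Λ₀` and its size
  set ℓ : ℝ := Real.log (T₁ + 4) with hℓ
  have hℓ1 : 1 ≤ ℓ := by
    rw [hℓ, Real.le_log_iff_exp_le (by linarith)]
    have := Real.exp_one_lt_d9
    linarith
  set Λ₀ : ℝ := Cr + 17 + 2 * ℓ + Ch * ℓ * (2 + ℓ / c₀) + M₀ with hΛ₀def
  have habsT : |T₁| = T₁ := abs_of_pos hT₁0
  have habsT' : |(-T₁)| = T₁ := by rw [abs_neg, habsT]
  have hlogT₁ : Real.log T₁ ≤ ℓ := Real.log_le_log hT₁0 (by linarith)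
  have hlogT₁2 : Real.log (T₁ + 2) ≤ ℓ := Real.log_le_log (by linarith) (by linarith)
  have hℓ0 : 0 ≤ ℓ := by linarith
  have hΛ₀ : ∀ t : ℝ, |t| = T₁ → Cr + 17 + 2 * Real.log |t| + Ch * Real.log (|t| + 4) / η + M₀ ≤ Λ₀ := by
    intro t ht
    rw [ht, ← hℓ]
    have h1 : Ch * ℓ / η ≤ Ch * ℓ * (2 + ℓ / c₀) := by
      rw [div_eq_mul_one_div]
      refine mul_le_mul_of_nonneg_left (hηinv.trans ?_) (by positivity)
      gcongr
    linarith
  have hΛ₀A : Λ₀ ≤ A₀ * ℓ ^ 2 := by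
    rw [hΛ₀def, hA₀]
    have hℓ2 : ℓ ≤ ℓ ^ 2 := by nlinarith
    have h1 : (1 : ℝ) ≤ ℓ ^ 2 := by nlinarith
    have h2 : Ch * ℓ * (2 + ℓ / c₀) = 2 * Ch * ℓ + Ch / c₀ * ℓ ^ 2 := by ring
    rw [h2]
    have p1 : 0 ≤ Cr * (ℓ ^ 2 - 1) := mul_nonneg hCr0.le (by linarith)
    have p2 : 0 ≤ M₀ * (ℓ ^ 2 - 1) := mul_nonneg hM₀0 (by linarith)
    have p3 : 0 ≤ Ch * (ℓ ^ 2 - ℓ) := mul_nonneg hCh0.le (by linarith)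
    have p4 : 0 ≤ Ch / c₀ := by positivity
    linarith [mul_comm (Ch / c₀) (ℓ ^ 2)]
  -- the two horizontal half-lines
  obtain ⟨hint_top, hHtop⟩ := horizontal_integral_bound hCr hCh hx1 hb (t := T₁)
    (by rw [habsT]; exact hT₁2) hη0 hη1 hZtop (hΛ₀ T₁ habsT) hCh0.le hCr0.le
  obtain ⟨hint_bot, hHbot⟩ := horizontal_integral_bound hCr hCh hx1 hb (t := -T₁)
    (by rw [habsT']; exact hT₁2) hη0 hη1 hZbot (hΛ₀ (-T₁) habsT') hCh0.le hCr0.le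
  rw [habsT] at hHtop
  rw [habsT'] at hHbot
  -- the contour
  have hB := rightEdge_identity hx1 hb1 hδ0 hδ2 hgap (by linarith : (1 : ℝ) ≤ T₁) hgood hint_top
    hint_bot
  -- Perron
  have hP := hPerron x hx T₁ (by linarith) b hb
  -- the zeros between `T` and `T₁`
  have hS := norm_zeroSum_sub_le hx1.le hT0 hT₁
  have hD := sum_order_sdiff_le hCw hT0.le hT₁'
  -- names
  set G : ℂ → ℂ := fun s ↦ (-deriv riemannZeta s / riemannZeta s) * ((x : ℂ) ^ s / s) with hG
  set V : ℂ := ∫ t in (-T₁)..T₁, G ((b : ℂ) + t * I) with hV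
  set Hb : ℂ := ∫ σ in Iic b, G ((σ : ℂ) + (-T₁ : ℝ) * I) with hHb
  set Ht : ℂ := ∫ σ in Iic b, G ((σ : ℂ) + T₁ * I) with hHt
  set S₁ : ℂ := ∑ ρ ∈ (weilZeroIndex_finite T₁).toFinset,
    (riemannZetaZeroOrder ρ : ℂ) * ((x : ℂ) ^ ρ / ρ) with hS₁
  set S : ℂ := ∑ ρ ∈ (weilZeroIndex_finite T).toFinset,
    (riemannZetaZeroOrder ρ : ℂ) * ((x : ℂ) ^ ρ / ρ) with hSdef
  set cterm : ℂ := ((-(1 / 2) * Real.log (1 - 1 / x ^ 2) : ℝ) : ℂ) with hcterm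
  set R₁ : ℂ := (x : ℂ) - S₁ - Complex.log (2 * π) + cterm with hR₁
  set D : ℝ := ∑ ρ ∈ (weilZeroIndex_finite T₁).toFinset \ (weilZeroIndex_finite T).toFinset,
    (riemannZetaZeroOrder ρ : ℝ) with hDdef
  have hπC : (2 * π : ℂ) ≠ 0 := by
    have : ((2 * π : ℝ) : ℂ) ≠ 0 := by exact_mod_cast (by positivity : (2 * π : ℝ) ≠ 0)
    push_cast at this; exact this
  have hnorm2π : ‖(2 * π : ℂ)‖ = 2 * π := by
    rw [show (2 * π : ℂ) = ((2 * π : ℝ) : ℂ) by norm_cast, Complex.norm_real, Real.norm_eq_abs,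
      abs_of_pos (by positivity)]
  -- `V = 2π R₁ + i (Hb − Ht)`
  have hVeq : V = 2 * π * R₁ + I * (Hb - Ht) := by
    have hI : I * I = -1 := I_mul_I
    have hB' : I * V = 2 * π * I * R₁ - Hb + Ht := by
      rw [hV, hR₁, hHb, hHt, hS₁, hcterm]
      exact hB
    linear_combination (-I) * hB' + (V - 2 * π * R₁) * hI
  -- Perron in our names
  have hP' : ‖V - 2 * π * (chebyshevPsi₀ x : ℂ)‖ ≤
      C₁ * (Real.log x * min 1 (x / (T₁ * primePowDist x)) + x / T₁ * Real.log x ^ 2) := by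
    rw [hV]; exact hP
  -- the target, decomposed
  have htarget : (chebyshevPsi₀ x : ℂ) -
      ((x : ℂ) - zetaZeroSumTrunc x T - Real.log (2 * π) - 1 / 2 * Real.log (1 - 1 / x ^ 2)) =
      ((chebyshevPsi₀ x : ℂ) - V / (2 * π)) + I * (Hb - Ht) / (2 * π) + (S - S₁) := by
    have hlog : ((Real.log (2 * π) : ℝ) : ℂ) = Complex.log (2 * π) := by
      rw [show (2 * π : ℂ) = ((2 * π : ℝ) : ℂ) by norm_cast, Complex.ofReal_log (by positivity)]
    have hzs : zetaZeroSumTrunc x T = S := rfl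
    rw [hzs, hlog, hVeq, hR₁, hcterm]
    push_cast
    field_simp
    ring
  -- sizes of the three pieces
  set E : ℝ := Real.log x * min 1 (x / (T * primePowDist x)) + x / T * Real.log (x * T) ^ 2 with hE
  set Q : ℝ := x / T * Real.log (x * T) ^ 2 with hQ
  have hpd := primePowDist_pos x
  have hlogxT : Real.log (x * T) = Real.log x + Real.log T := Real.log_mul hx0.ne' hT0.ne'
  have hlogT : Real.log 2 ≤ Real.log T := Real.log_le_log two_pos hT
  have hlog2 : (1 / 2 : ℝ) < Real.log 2 := by have := Real.log_two_gt_d9; linarith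
  have hlogT0 : 0 < Real.log T := by linarith
  have hLxT : Real.log x ≤ Real.log (x * T) := by rw [hlogxT]; linarith
  have hlogxT0 : 1 / 2 ≤ Real.log (x * T) := by linarith
  have hmin0 : 0 ≤ min 1 (x / (T * primePowDist x)) := le_min zero_le_one (by positivity)
  have hQ0 : 0 ≤ Q := by positivity
  have hQE : Q ≤ E := by rw [hE, hQ]; linarith [mul_nonneg hL0.le hmin0]
  have hE0 : 0 ≤ E := hQ0.trans hQE
  have hxT : x / T₁ ≤ x / T := div_le_div_of_nonneg_left hx0.le hT0 hT₁
  have hxT0 : 0 ≤ x / T := by positivity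
  -- (1) Perron
  have h1 : ‖(chebyshevPsi₀ x : ℂ) - V / (2 * π)‖ ≤ C₁ * E := by
    have hπ : (0 : ℝ) < 2 * π := by positivity
    have e1 : (chebyshevPsi₀ x : ℂ) - V / (2 * π) = -(V - 2 * π * (chebyshevPsi₀ x : ℂ)) / (2 * π) := by
      field_simp
      ring
    rw [e1, norm_div, norm_neg, hnorm2π, div_le_iff₀ hπ]
    refine hP'.trans ?_
    have hEA : Real.log x * min 1 (x / (T₁ * primePowDist x)) + x / T₁ * Real.log x ^ 2 ≤ E := by
      rw [hE]
      refine add_le_add ?_ ?_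
      · refine mul_le_mul_of_nonneg_left (min_le_min_left _ ?_) hL0.le
        exact div_le_div_of_nonneg_left hx0.le (by positivity) (mul_le_mul_of_nonneg_right hT₁ hpd.le)
      · exact mul_le_mul hxT (pow_le_pow_left₀ hL0.le hLxT 2) (by positivity) hxT0
    calc C₁ * (Real.log x * min 1 (x / (T₁ * primePowDist x)) + x / T₁ * Real.log x ^ 2) ≤ C₁ * E :=
          mul_le_mul_of_nonneg_left hEA hC₁0.le
      _ ≤ C₁ * E * (2 * π) := by
          have : (1 : ℝ) ≤ 2 * π := by linarith [Real.pi_gt_three]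
          have h0 : 0 ≤ C₁ * E := by positivity
          exact le_mul_of_one_le_right h0 this
  -- (2) the horizontal integrals
  have hℓQ : ℓ ^ 2 * (x / T₁) ≤ 9 * Q := by
    have hℓ3 : ℓ ≤ 3 * Real.log (x * T) := by
      have h4 : Real.log (T₁ + 4) ≤ Real.log (4 * T) := Real.log_le_log (by linarith) (by linarith)
      have h44 : Real.log (4 * T) = Real.log 4 + Real.log T := Real.log_mul (by norm_num) hT0.ne'
      have hl4 : Real.log 4 = 2 * Real.log 2 := by
        rw [show (4 : ℝ) = 2 ^ 2 by norm_num, Real.log_pow]; norm_num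
      rw [hℓ]; linarith
    have : ℓ ^ 2 ≤ 9 * Real.log (x * T) ^ 2 := by
      calc ℓ ^ 2 ≤ (3 * Real.log (x * T)) ^ 2 := pow_le_pow_left₀ hℓ0 hℓ3 2
        _ = 9 * Real.log (x * T) ^ 2 := by ring
    rw [hQ]
    calc ℓ ^ 2 * (x / T₁) ≤ (9 * Real.log (x * T) ^ 2) * (x / T) := mul_le_mul this hxT (by positivity) (by positivity)
      _ = 9 * (x / T * Real.log (x * T) ^ 2) := by ring
  have hH : ∀ H : ℂ, ‖H‖ ≤ Real.exp 1 * x * (Λ₀ / Real.log x + 20 / (Real.exp 1 * Real.log x ^ 2)) / T₁ →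
      ‖H‖ ≤ 9 * A₁ * Q := by
    intro H hH
    refine hH.trans ?_
    have hlam2 : lam ^ 2 ≤ Real.log x ^ 2 := pow_le_pow_left₀ hlam0.le hLlam 2
    have h1 : Λ₀ / Real.log x ≤ A₀ * ℓ ^ 2 / lam :=
      div_le_div₀ (by positivity) hΛ₀A hlam0 hLlam
    have h2 : 20 / (Real.exp 1 * Real.log x ^ 2) ≤ 20 / (Real.exp 1 * lam ^ 2) * ℓ ^ 2 := by
      calc 20 / (Real.exp 1 * Real.log x ^ 2) ≤ 20 / (Real.exp 1 * lam ^ 2) :=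
            div_le_div_of_nonneg_left (by norm_num) (by positivity)
              (mul_le_mul_of_nonneg_left hlam2 (Real.exp_pos 1).le)
        _ ≤ 20 / (Real.exp 1 * lam ^ 2) * ℓ ^ 2 := le_mul_of_one_le_right (by positivity) (one_le_pow₀ hℓ1)
    calc Real.exp 1 * x * (Λ₀ / Real.log x + 20 / (Real.exp 1 * Real.log x ^ 2)) / T₁
        ≤ Real.exp 1 * x * (A₀ * ℓ ^ 2 / lam + 20 / (Real.exp 1 * lam ^ 2) * ℓ ^ 2) / T₁ := by
          gcongr
      _ = A₁ * (ℓ ^ 2 * (x / T₁)) := by rw [hA₁]; field_simp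
      _ ≤ A₁ * (9 * Q) := mul_le_mul_of_nonneg_left hℓQ hA₁0
      _ = 9 * A₁ * Q := by ring
  have h2 : ‖I * (Hb - Ht) / (2 * π)‖ ≤ 3 * A₁ * Q := by
    have hπ : (0 : ℝ) < 2 * π := by positivity
    rw [norm_div, norm_mul, Complex.norm_I, one_mul, hnorm2π, div_le_iff₀ hπ]
    have hb' := hH Hb hHbot
    have ht' := hH Ht hHtop
    calc ‖Hb - Ht‖ ≤ ‖Hb‖ + ‖Ht‖ := norm_sub_le _ _
      _ ≤ 9 * A₁ * Q + 9 * A₁ * Q := add_le_add hb' ht'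
      _ ≤ 3 * A₁ * Q * (2 * π) := by
          have h0 : 0 ≤ A₁ * Q := by positivity
          have h18 : (18 : ℝ) ≤ 3 * (2 * π) := by linarith [Real.pi_gt_three]
          calc 9 * A₁ * Q + 9 * A₁ * Q = 18 * (A₁ * Q) := by ring
            _ ≤ 3 * (2 * π) * (A₁ * Q) := mul_le_mul_of_nonneg_right h18 h0
            _ = 3 * A₁ * Q * (2 * π) := by ring
  -- (3) the zeros between `T` and `T₁`
  have h3 : ‖S - S₁‖ ≤ 24 * Cw * Q := by
    rw [norm_sub_rev]
    refine hS.trans ?_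
    have hlog52 : Real.log (T + 5 / 2) ≤ 3 * Real.log (x * T) := by
      have h4 : Real.log (T + 5 / 2) ≤ Real.log (4 * T) := Real.log_le_log (by linarith) (by linarith)
      rw [Real.log_mul (by norm_num) hT0.ne', show (4 : ℝ) = 2 * 2 by norm_num,
        Real.log_mul two_ne_zero two_ne_zero] at h4
      linarith
    have hlsq : Real.log (x * T) ≤ 2 * Real.log (x * T) ^ 2 := by nlinarith
    calc x / T * D ≤ x / T * (4 * Cw * Real.log (T + 5 / 2)) := mul_le_mul_of_nonneg_left hD hxT0
      _ ≤ x / T * (4 * Cw * (3 * (2 * Real.log (x * T) ^ 2))) := by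
          refine mul_le_mul_of_nonneg_left ?_ hxT0
          refine mul_le_mul_of_nonneg_left (hlog52.trans (by linarith)) (by positivity)
      _ = 24 * Cw * Q := by rw [hQ]; ring
  -- conclusion
  rw [htarget]
  calc ‖((chebyshevPsi₀ x : ℂ) - V / (2 * π)) + I * (Hb - Ht) / (2 * π) + (S - S₁)‖
      ≤ ‖(chebyshevPsi₀ x : ℂ) - V / (2 * π)‖ + ‖I * (Hb - Ht) / (2 * π)‖ + ‖S - S₁‖ := norm_add₃_le
    _ ≤ C₁ * E + 3 * A₁ * Q + 24 * Cw * Q := by gcongr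
    _ ≤ (C₁ + 3 * A₁ + 24 * Cw) * E := by
        have p1 : 0 ≤ Cw * (E - Q) := mul_nonneg hCw0.le (by linarith)
        have p2 : 0 ≤ A₁ * (E - Q) := mul_nonneg hA₁0 (by linarith)
        linarith

end Literature.NumberTheory.LFunctions

end
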